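import Mathlib
import HarnessLib
import HarnessLib.Audit
import Summits.PneNP.Statement
import Literature.Computability.Complexity.Classes
import Literature.Computability.Complexity.Nondeterministic
import Literature.Computability.Complexity.CircuitClasses
import Literature.Computability.Complexity.ClayProblem
import Literature.Computability.Complexity.NPBridge
import HarnessLib.Audit.Status.Attr

/-!
Route: PermanentDescent

DORMANT since 2026-08-24T09:54:27Z (reconciler: no traction for 6.7 d (last activity item-evidence-added at 2026-08-17T16:57:05Z); parked, not closed — `ledger route dormant route-PneNP-PermanentDescent --off` to reactivate) — unstaffed, not closed; items shared with open routes are served there. `ledger route dormant <id> --off` reactivates.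

# Route PermanentDescent — P ≠ NP from a WEAKER summit — the permanent — plus "Algorithmica forces
Countica"

It suffices to show X = W ∧ K, a FACTORISATION of P ≠ NP into two statements each logically WEAKER
than it (every other PneNP
route proves the summit from a STRONGER hypothesis). W (crux PermanentNotInP): the 0/1 PERMANENT is
not computable in polynomial time —
its bit-graph language PermBits = {⟨s, bin i⟩ : s ∈ {0,1}^{n·n}, bit i of perm(M_s) over ℕ is 1} is
not in P (W ⟸ P ≠ NP by
Valiant's #P-completeness of the 0/1 permanent; W ⟺ P ≠ P^{#P}). K (crux
CollapseMakesPermanentEasy): a uniform collapse NP ⊆ P forces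
the permanent into P ("there is no Algorithmica without Countica": the first collapse propagation
ABOVE the polynomial hierarchy,
Toda 1991; an implication between two believed-false statements, the Karp–Lipton genre; K ⟸ P ≠ NP
vacuously). K splits (foreseen,
typed, glue proved in the planner's SketchK.lean) into the provable-now support
UniformizationUnderCollapse — under NP ⊆ P circuits
for the permanent can be FOUND and CERTIFIED row by row (Laplace expansion = downward self-reduction
+ Σ₂-search in the collapsed
hierarchy), so P/poly ⇒ P for the permanent in Algorithmica — and the purely NON-UNIFORM core
CollapseShrinksPermanent (support):
NP ⊆ P → PermBits ∈ P/poly, "a fast SAT algorithm yields small permanent circuits". No card realised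
(lens move37, planner's own
line); nearest cards: sat-not-a-permanent-spp (SAT ∉ SPP, a STRONGER hypothesis),
approximate-counting-islands (stops at approximate
counting, where the propagation is Stockmeyer's theorem).
Lean: `(let PermBits : Language Bool := {w | ∃ (n : ℕ) (s : List Bool) (i : ℕ), s.length = n * n ∧ w
= Literature.Computability.Complexity.boolPair s (Computability.encodeNat i) ∧ Nat.testBit
(Matrix.permanent (Matrix.of fun a b : Fin n => if s.getD ((b : ℕ) + n * (a : ℕ)) false then (1 : ℕ)
else 0)) i = true}; PermBits ∉ Literature.Computability.Complexity.Classes.P) ∧ (let PermBits :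
Language Bool := {w | ∃ (n : ℕ) (s : List Bool) (i : ℕ), s.length = n * n ∧ w =
Literature.Computability.Complexity.boolPair s (Computability.encodeNat i) ∧ Nat.testBit
(Matrix.permanent (Matrix.of fun a b : Fin n => if s.getD ((b : ℕ) + n * (a : ℕ)) false then (1 : ℕ)
else 0)) i = true}; Literature.Computability.Complexity.Nondeterministic.NP ⊆
Literature.Computability.Complexity.Classes.P → PermBits ∈
Literature.Computability.Complexity.Classes.P)`

## Assembly
Pure logic (sorry-free, deciding theorem `closes`, crux-only): assume ¬PneNP; the proved model
bridges `P_bool_eq_holds` and `np_bool_eq`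
turn it into NP ⊆ P over the Cook–Karp classes; CollapseMakesPermanentEasy gives PermBits ∈ P,
contradicting PermanentNotInP. The
supports compose to the crux by `fun u k h => u h (k h)` (UniformizationUnderCollapse →
CollapseShrinksPermanent → CollapseMakesPermanentEasy).

Rationale: WHY THIS LINE. Invert the field's habit of STRENGTHENING the target: descend to the first class
above the polynomial hierarchy (Toda1991: PH ⊆ P^{#P})
and attack its complete function, the permanent, where the only NON-RELATIVIZING lower bounds for
natural classes already exist —
PP ⊄ SIZE(n^k) for every k (Vinodchandran2005; by Aaronson2006 p. 4 "the first nonrelativizing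
separation that does not involve
artificial classes", since PP has linear-size circuits relative to an oracle), perm ∉
DLOGTIME-uniform ACC⁰/TC⁰ (AllenderGore1994,
Allender1999) and perm ∉ uniform threshold circuits of depth o(log log n) (KoiranPerifel2009) — all
powered by the LFKN1992 interactive
proof for the permanent (downward + random self-reducibility), a structure SAT provably lacks unless
PH collapses. The price of the
descent is the propagation crux K = CollapseMakesPermanentEasy (NP ⊆ P → permanent ∈ P); its uniform
half is a theorem of "algorithm design in Algorithmica" (support U: with NP ⊆ P one
finds and certifies permanent circuits level by level, the exact, derandomised form of the
circuit-learning bootstraps of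
KarpLipton1980 / BshoutyEtAl1996 / ImpagliazzoWigderson2001 / BabaiEtAl1993), so the residue of K is
purely the NON-UNIFORM support CollapseShrinksPermanent, "a
polynomial-time SAT algorithm implies small circuits for the permanent" — an UPPER-bound task immune
to Razborov–Rudich and, as far
as searched, obstructed by no oracle (no relativized world with P = NP ≠ PP, or even P = NP ≠
PSPACE, is recorded: Ko1989 §6.2
collapses Σₖ = Σₖ₊₁ with PSPACE separate only for k ≥ 1). Imported areas: counting complexity and
interactive proofs (LFKN,
Toda), exact learning / search-to-decision under collapse; algebra of the permanent (Laplace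
expansion over ℕ; Lipton's
interpolation over 𝔽_p foreseen as a layer-2 child). What prior routes do not: all 43 open PneNP
routes assume MORE than the summit;
this one assumes a separation implied by it plus a collapse statement implied by it, and hands each
half to a toolkit (counting-hierarchy
diagonalization with sumcheck; algorithmics under PH = P) that cannot even be phrased for SAT.

RANKED CRUXES. #2 CollapseMakesPermanentEasy (crux) — NO ALGORITHMICA WITHOUT COUNTICA: if NP ⊆ P
(Cook–Karp classes over {0,1}) then the bit-graph language PermBits of the 0/1 permanent is in P (⟺
P = P^{#P} by Valiant1979); the first collapse propagation above PH (Toda1991); an implication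
between two believed-false statements (Karp–Lipton genre). [difficulty: open-problem] (why it might
fail: no EXISTENCE mechanism for permanent circuits/algorithms from a uniform collapse is known; a
black-box proof would put #P inside FP^NP (CH ⊆ PH); if an oracle with NP^A ⊆ P^A but PP^A ⊄ P^A and
an algebrizing analogue exist, KL/IKW/LFKN-type arguments are all excluded.) [Toda1991,
KarpLipton1980, LFKN1992, Ko1989, AaronsonWigderson2009, ImpagliazzoWigderson2001, BshoutyEtAl1996,
Aaronson2006]
#3 PermanentNotInP (crux) — the 0/1 permanent is not polynomial-time computable: PermBits ∉ P (⟺ P ≠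
P^{#P} by Valiant1979; implied by P ≠ NP; to be climbed on the uniform ladder ACC⁰ ✓
(AllenderGore1994), TC⁰ ✓ (Allender1999), threshold depth o(log log n) ✓ (KoiranPerifel2009), NC¹,
L, NL, NC, P). [difficulty: open-problem] (why it might fail: general techniques inherit the
summit's relativization/algebrization walls (P^A = P^{#P^A} for PSPACE-complete A); the
LFKN/counting-hierarchy ladder has been stuck at uniform TC⁰ and depth o(log log n) since 2009; perm
mod 2^k ∈ FP (Valiant) so only odd moduli/ℤ carry hardness.) [Valiant1979, AllenderGore1994,
Allender1999, KoiranPerifel2009, Vinodchandran2005, Aaronson2006, LFKN1992]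
#9 UniformizationUnderCollapse (support, provable-now) — ALGORITHM DESIGN IN ALGORITHMICA: if NP ⊆ P
and PermBits ∈ P/poly then PermBits ∈ P. Proof to formalise: NP ⊆ P gives PH = P; for m = 1…n find
the lex-first circuit D_m of size ≤ m^t passing the coNP (= P) test ∀M ∈ {0,1}^{m×m}: val D_m(M) =
Σ_j M_{1j}·val D_{m−1}(M^{(1j)}) (Laplace expansion of the permanent along row 1; D_1(M) = M_{11})
by Σ₂ (= P) prefix search, raising t until every level succeeds; by induction D_n computes perm_n
exactly; total time polynomial. [KarpLipton1980, BshoutyEtAl1996, ImpagliazzoWigderson2001,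
BabaiEtAl1993, Aaronson2006]
#9 CollapseShrinksPermanent (support; the non-uniform core of #2) — NP ⊆ P → PermBits ∈ P/poly; with
UniformizationUnderCollapse it implies #2 by `fun u k h => u h (k h)` (checked in the planner's
SketchK.lean); kept as the foreseen split child of #2. [Toda1991, KarpLipton1980, LFKN1992]

TWO-LAYER PLAN. Foreseen glued splits, none filed now. PermanentNotInP ⇐ uniform rungs once
DLOGTIME-uniform threshold/NC¹ families are typed
(definition request below): PermNotUniformTC0 (Allender1999, provable-from-literature) →
PermNotUniformNC1 (open) → PermNotL (open) →
PermanentNotInP, each rung by "perm ∈ 𝒞 ⇒ CH collapses to 𝒞 ⇒ contradiction with a 𝒞-hierarchy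
theorem" (the LFKN/Toda/Kannan engine of
Vinodchandran2005). CollapseMakesPermanentEasy ⇐ UniformizationUnderCollapse →
CollapseShrinksPermanent (glue `fun u k h => u h (k h)`, to be filed by `route edit --split` in
tenure); then CollapseShrinksPermanent ⇐ (i) AverageCaseFormUnderCollapse: NP ⊆ P → (circuits
computing perm mod p on a
1 − 1/(3n) fraction of matrices ⇒ PermBits ∈ P/poly) (Lipton 1991 interpolation, derandomised by PH
= P; provable-now) → (ii) the
residual average-case existence statement; or (iii) the modular rung NP ⊆ P → Mod₃-permanent ∈
P/poly first (perm mod 2^k is free,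
Valiant1979). A #SAT twin of U (variable-splitting self-reduction, tree `countSat`) is an
alternative support if the matrix encoding
proves awkward.

KILL CRITERIA. (a) ENGINE KILL: a refuter exhibits BOTH an oracle A with NP^A ⊆ P^A and PP^A ⊄
P^A/poly AND an algebrizing pair (AaronsonWigderson2009
§5 style) with NP^{Ã} ⊆ P^{A}, PP^{A} ⊄ P^{Ã}/poly — then Karp–Lipton-, IKW- and LFKN-type
techniques are all excluded for
CollapseShrinksPermanent and the planner retires the route `exhausted` (engine-less), keeping U and
any proved rungs as banked
support. (b) A theorem "CollapseMakesPermanentEasy ⇒ P ≠ NP" by a relativizing argument would expose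
the crux as the summit in
costume — retire `not-a-thesis`. (c) PermanentNotInP refuted (PermBits ∈ P) decides the summit
NEGATIVELY (P = NP via Valiant) —
moot, and historic. (d) A proof elsewhere of NP ⊄ P/poly or NP ≠ coNP moots the route (summit closed
by a stronger line).

NOT DECOMPOSED YET. The uniform-circuit rungs of PermanentNotInP (need DLOGTIME/FO-uniform TC⁰, NC¹
typed; filed as a definition request, not as items);
the average-case (Lipton) and modular (Mod₃) forms of CollapseShrinksPermanent; the #SAT twin of the
support; any use of
Valiant's #P-completeness of the 0/1 permanent (only needed to SEE that W is weaker than the summit,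
never by `closes`).

CHEAPEST FALSIFIER. Two lookups, both run as far as the hub's tools allowed (remote search
rate-limited 2026-08-16; local `lit read` of Ko1989 and
Aaronson2006 done): (1) is "P = NP ⇒ P = PP" (or ⇒ P^{#P} ⊆ P/poly, or ⇒ P = PSPACE) settled in
print either way, or is a relativized
counter-world (P^A = NP^A with PP^A ⊄ P^A/poly) recorded? Ko1989 §6.2 (read, p. 27) gives Σₖ^A =
Σₖ₊₁^A ≠ Σₖ₋₁^A with PSPACE^A
separate only for k ≥ 1 — the k = 0 case is exactly the test and I found no record; Aaronson2006
(read, pp. 4, 6) maps the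
relativized landscape of PP's circuit size but always on the side "PP small relative to A". (2) does
Valiant's perm-mod-2^k algorithm or
any known structure put PermBits restricted to a large explicit matrix family in P in a way that
makes W's ladder vacuous? (No: the
language ranges over all 0/1 matrices.) A refuter who finds (1) positive downgrades the engine claim
(see Kill criteria (a)).

NUMBERS. Proved rungs under W: perm ∉ DLOGTIME-uniform ACC⁰ (AllenderGore1994, SIAM J. Comput.
23(5)); perm ∉ DLOGTIME-uniform TC⁰ of polynomial
size (Allender1999, Chicago J. TCS 1999:7); perm ∉ uniform threshold circuits of depth o(log log n)
and polynomial size (KoiranPerifel2009,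
arXiv:0902.1866); PP ⊄ SIZE(n^k) for each k, non-relativizing (Vinodchandran2005; Aaronson2006
oracle with PP ⊆ SIZE^A(O(n))). Known
propagations from NP ⊆ P: PH, BPP, MA, AM, S₂P, ZPP^NP, approximate counting (Stockmeyer), witness
sampling (JVV), exact circuit
learning (BshoutyEtAl1996) — everything up to and including PH; nothing at PP/#P (first open level,
Toda1991). Items after the repair edit: 5 (2 cruxes, 2 supports, 1 assembly).

DEFINITION REQUESTS. DLOGTIME-uniform (equivalently FO[+,×]-uniform) families of threshold circuits
(`UniformTC0`) and of NC¹ circuits over the tree's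
`tcBasis` / `Circuit`, so that the proved rungs AllenderGore1994 / Allender1999 / KoiranPerifel2009
of PermanentNotInP can be typed as
support items (to be filed with `ledger workitem add --kind definition --notion UniformTC0 --topic
Literature/Computability/Complexity`).
Cite facts wanted later (not now): Valiant1979 #P-completeness of the 0/1 permanent
(`IsSharpPHardFun` of the permanent), Allender1999 Thm.

Novelty: Searches (2026-08-16): `ledger route list` (43 open PneNP routes read by thesis header: every one
assumes a hypothesis stronger than or
incomparable with the summit); grep of all 100 open + 66 closed PneNP idea cards for Toda / LFKN /
Allender / "P = PP" / permanent /
counting hierarchy (hits: sat-not-a-permanent-spp = SAT ∉ SPP, stronger-X shape, graded known;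
approximate-counting-islands = no-FPRAS ⇒
P ≠ NP via Stockmeyer; uncheckable-sat-prover-ladder = IP with NP-prover; none factorises the summit
into weaker conjuncts or uses a
counting propagation); `lit frontier PneNP --since 2021` (30 rows: EF/Pich–Santhanam,
meta-complexity, monotone matching — no counting
propagation); `lit bridges PneNP --cross any`; `lit read arxiv:2203.14379` (CJSW constructive
separations, pp. 5–7, 13 — rejected as a
lever, see NOTES); `lit read doi:10.1007/978-94-009-2411-6_2` (Ko1989 §4.1, §6.2); `lit read
arxiv:cs/0504048` (Aaronson2006 pp. 4, 6);
`lit vsearch` for Allender's uniform TC⁰ bound (Jukna2012 pp. 335–356, AroraBarak2009 hits); `lit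
galaxy search --star all` ×2 for
"P = NP but P ≠ PSPACE / PP" (0 relevant hits); `lit cite` verification of Vinodchandran2005,
Allender1999, AllenderGore1994,
KoiranPerifel2009, ImpagliazzoWigderson2001, BshoutyEtAl1996, BabaiEtAl1993 (all added to
references.bib). Remote OpenAlex/S2 search
was rate-limited all session (noted; the refuter's novelty audit should re-run `lit search "P = NP
implies P = PP counting hierarchy collapse"`).
Nearest prior art f  [refs: 10.1007/978-94-009-2411-6_2`, 2203.14379, cs/0504048, arxiv:2203.14379, doi:10.1007/978-94-009-2411-6_2, arxiv:cs/0504048, Ko1989, Aaronson2006, Jukna2012, AroraBarak2009, Vinodchandran2005, Allender1999, AllenderGore1994, KoiranPerifel2009, ImpagliazzoWigderson2001, BshoutyEtAl1996, BabaiEtAl1993, Toda1991, KarpLipton1980]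

Barriers (technique_class: collapse-propagation, counting-complexity, LFKN-ladder): - technique_class: collapse-propagation, counting-complexity, LFKN-ladder
- Literature.Barriers.PneNP.Relativization: the assembly relativizes (harmless). PermanentNotInP,
like the summit, fails relative to a PSPACE-complete oracle, so its general proof must be
non-relativizing — and the chosen class is the one place where that is ALREADY done for natural
classes (Vinodchandran2005 via LFKN; Aaronson2006 p. 4); the rungs use #P-completeness of the
permanent, a non-black-box ingredient. CollapseShrinksPermanent: an implication; no contrary oracle
(NP^A ⊆ P^A with PP^A ⊄ P^A/poly) is on record (Ko1989 §6.2 only reaches Σₖ = Σₖ₊₁ ≠ PSPACE for k ≥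
1) — the barrier is not known to apply, and finding such an oracle is the refuter's first task; if
it exists, the bet is on the LFKN/IKW family of non-relativizing collapse arguments.
- Literature.Barriers.PneNP.BoundedRelativization: same status — the PSPACE-complete oracle kills
both the summit and W as PSPACE-relativizing statements; K is vacuously true there (everything
collapses), so no PSPACE-oracle obstructs K.
- Literature.Barriers.PneNP.Algebrization: AaronsonWigderson2009 Thm 5.1 (NP^Ã ⊆ P^A, A
PSPACE-complete) again collapses PP too, so it does not obstruct K; whether a separating algebrizing
pair for K exists is OPEN and is kill criterion (a) — conceded: LFKN/sumcheck algebrize, so if such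
a pair exists the route's named engine for K is gone. For W the barrier bites exactly as for the
summit; it does not bite the uniform run

History (route lifecycle, newest last):
- 2026-08-16T17:18:29Z · rev 3: restated CollapseMakesPermanentEasy (stmt-PneNP-16010), PermanentNotInP (stmt-PneNP-16001), CollapseShrinksPermanent (stmt-PneNP-16000), UniformizationUnderCollapse (stmt-PneNP-16002) — cone repair (route-repair seat): imports trimmed 6→5 — DROP Literature.Computability.Complexity.DirectedHamiltonCircuit (import (planner-rrepair-PneNP-PermanentDescent-79a32aa7-0)
- 2026-08-24T09:54:27Z · DORMANT — reconciler: no traction for 6.7 d (last activity item-evidence-added at 2026-08-17T16:57:05Z); parked, not closed — `ledger route dormant route-PneNP-PermanentD (operator:999:886291)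

sub-problem: PneNP · status: dormant · opened planner-plan-lens-PneNP-move37-v2-g2-0 2026-08-16T17:02:49Z · rev 3 · ledger route-PneNP-PermanentDescent
GENERATED by the gate from the ledger (D-0016/17). Provers cite these decls: `theorem foo : Summit.PneNP.PneNP.Theses.PermanentDescent.<Decl> := …` in Summits/PneNP/PneNP/Theorems/<Name>.lean.
-/

namespace Summit.PneNP.PneNP.Theses.PermanentDescent

open scoped BigOperators Topology Manifold Classical MeasureTheory ProbabilityTheory Matrix InnerProductSpace ComplexConjugate ContinuousMap
open Filter Set Function TopologicalSpace MeasureTheory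

attribute [summit_statement] _root_.PneNP

open Literature.PNP

-- earlier CollapseMakesPermanentEasy (stmt-PneNP-16010, replaced 2026-08-16T17:18:29Z -> stmt-PneNP-16142): retired by None — let PermBits : Language Bool := {w | ∃ (n : ℕ) (s : List Bool) (hs : s.length = n * n) (i : ℕ), w = Literature.Computability.Complexity.boolPair s (Computability.encodeNat i) ∧ Nat.testBit (Matrix.permanent (Matrix.of fun a b : Fin n => if Literature.Computability.Complexity.
/-- item stmt-PneNP-16142 · crux · rank 2 · open · by planner
why it might fail: No EXISTENCE mechanism for permanent circuits/algorithms from a uniform collapse is known; a black-box proof would put #P inside FP^NP (CH ⊆ PH); if an oracle with NP^A ⊆ P^A but PP^A ⊄ P^A and an algebrizing analogue exist, KL/IKW/LFKN-type arguments are all excluded.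
sources: Toda1991, KarpLipton1980, LFKN1992, Ko1989, AaronsonWigderson2009, ImpagliazzoWigderson2001
[crux] NO ALGORITHMICA WITHOUT COUNTICA: if NP ⊆ P (Cook–Karp classes over {0,1}) then the bit-graph
language PermBits of the 0/1 permanent is in P (⟺ P = P^{#P} by Valiant1979). The first collapse
propagation ABOVE the polynomial hierarchy (Toda1991: PH ⊆ P^{#P}); an implication between two
believed-false statements (Karp–Lipton genre), vacuously implied by P ≠ NP. Foreseen split:
CollapseMakesPermanentEasy ⇐ UniformizationUnderCollapse (provable-now: find-and-certify permanent
circuits by Laplace self-reduction + Σ₂-search under PH = P) → CollapseShrinksPermanent (the purely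
NON-UNIFORM core: NP ⊆ P → PermBits ∈ P/poly). -/
@[route_item "route-PneNP-PermanentDescent", crux]
def CollapseMakesPermanentEasy : Prop :=
  let PermBits : Language Bool := {w | ∃ (n : ℕ) (s : List Bool) (i : ℕ), s.length = n * n ∧ w = Literature.Computability.Complexity.boolPair s (Computability.encodeNat i) ∧ Nat.testBit (Matrix.permanent (Matrix.of fun a b : Fin n => if s.getD ((b : ℕ) + n * (a : ℕ)) false then (1 : ℕ) else 0)) i = true}; Literature.Computability.Complexity.Nondeterministic.NP ⊆ Literature.Computability.Complexity.Classes.P → PermBits ∈ Literature.Computability.Complexity.Classes.P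

-- earlier PermanentNotInP (stmt-PneNP-16001, replaced 2026-08-16T17:18:29Z -> stmt-PneNP-16143): retired by None — let PermBits : Language Bool := {w | ∃ (n : ℕ) (s : List Bool) (hs : s.length = n * n) (i : ℕ), w = Literature.Computability.Complexity.boolPair s (Computability.encodeNat i) ∧ Nat.testBit (Matrix.permanent (Matrix.of fun a b : Fin n => if Literature.Computability.Complexity.matrixOfBit
/-- item stmt-PneNP-16143 · crux · rank 3 · open · by planner
why it might fail: General techniques inherit the summit's relativization/algebrization walls (P^A = P^{#P^A} for PSPACE-complete A); the LFKN/counting-hierarchy ladder has been stuck at uniform TC⁰ and depth o(log log n) since 2009; perm mod 2^k ∈ FP (Valiant) so only odd moduli/ℤ carry hardness.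
sources: Valiant1979, AllenderGore1994, Allender1999, KoiranPerifel2009, Vinodchandran2005, Aaronson2006
[crux] the 0/1 permanent is not polynomial-time computable: PermBits ∉ P (⟺ P ≠ P^{#P} by
Valiant1979; implied by P ≠ NP; to be climbed on the uniform ladder ACC⁰ ✓ (AllenderGore1994), TC⁰ ✓
(Allender1999), threshold depth o(log log n) ✓ (KoiranPerifel2009), NC¹, L, NL, NC, P). [difficulty:
open-problem] -/
@[route_item "route-PneNP-PermanentDescent", crux]
def PermanentNotInP : Prop :=
  let PermBits : Language Bool := {w | ∃ (n : ℕ) (s : List Bool) (i : ℕ), s.length = n * n ∧ w = Literature.Computability.Complexity.boolPair s (Computability.encodeNat i) ∧ Nat.testBit (Matrix.permanent (Matrix.of fun a b : Fin n => if s.getD ((b : ℕ) + n * (a : ℕ)) false then (1 : ℕ) else 0)) i = true}; PermBits ∉ Literature.Computability.Complexity.Classes.P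

-- earlier CollapseShrinksPermanent (stmt-PneNP-16000, replaced 2026-08-16T17:18:29Z -> stmt-PneNP-16144): retired by None — let PermBits : Language Bool := {w | ∃ (n : ℕ) (s : List Bool) (hs : s.length = n * n) (i : ℕ), w = Literature.Computability.Complexity.boolPair s (Computability.encodeNat i) ∧ Nat.testBit (Matrix.permanent (Matrix.of fun a b : Fin n => if Literature.Computability.Complexity.ma
/-- item stmt-PneNP-16144 · support · rank 2 · open · by planner
why it might fail: No EXISTENCE mechanism for permanent circuits from a uniform collapse is known; a black-box proof would give #P ⊆ FP^NP (CH inside PH); if an oracle with NP^A ⊆ P^A, PP^A ⊄ P^A/poly plus an algebrizing analogue exist, KL/IKW/LFKN-type arguments are all excluded.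
sources: Toda1991, KarpLipton1980, LFKN1992
[crux] if NP ⊆ P (Cook–Karp classes over {0,1}) then the bit-graph language PermBits of the 0/1
permanent has polynomial-size B₂-circuit families (PermBits ∈ P/poly). Equivalently, given support
U: NP ⊆ P → PermBits ∈ P ("no Algorithmica without Countica"; first level above PH, Toda1991).
[difficulty: open-problem] -/
@[route_item "route-PneNP-PermanentDescent", crux]
def CollapseShrinksPermanent : Prop :=
  let PermBits : Language Bool := {w | ∃ (n : ℕ) (s : List Bool) (i : ℕ), s.length = n * n ∧ w = Literature.Computability.Complexity.boolPair s (Computability.encodeNat i) ∧ Nat.testBit (Matrix.permanent (Matrix.of fun a b : Fin n => if s.getD ((b : ℕ) + n * (a : ℕ)) false then (1 : ℕ) else 0)) i = true}; Literature.Computability.Complexity.Nondeterministic.NP ⊆ Literature.Computability.Complexity.Classes.P → PermBits ∈ Literature.Computability.Complexity.PPoly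

-- earlier UniformizationUnderCollapse (stmt-PneNP-16002, replaced 2026-08-16T17:18:29Z -> stmt-PneNP-16145): retired by None — let PermBits : Language Bool := {w | ∃ (n : ℕ) (s : List Bool) (hs : s.length = n * n) (i : ℕ), w = Literature.Computability.Complexity.boolPair s (Computability.encodeNat i) ∧ Nat.testBit (Matrix.permanent (Matrix.of fun a b : Fin n => if Literature.Computability.Complexity
/-- item stmt-PneNP-16145 · support · rank 9 · closed · proved by Summit.PneNP.PneNP.Theorems.uniformizationUnderCollapse_proof @ 8b41234b531f (prover) · by planner
sources: KarpLipton1980, BshoutyEtAl1996, ImpagliazzoWigderson2001, BabaiEtAl1993, Aaronson2006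
[support] ALGORITHM DESIGN IN ALGORITHMICA: if NP ⊆ P and PermBits ∈ P/poly then PermBits ∈ P. Proof
to formalise: NP ⊆ P gives PH = P; for m = 1…n find the lex-first circuit D_m of size ≤ m^t passing
the coNP (= P) test ∀M ∈ {0,1}^{m×m}: val D_m(M) = Σ_j M_{1j}·val D_{m−1}(M^{(1j)}) (Laplace
expansion of the permanent along row 1; D_1(M) = M_{11}) by Σ₂ (= P) prefix search, raising t until
every level succeeds; by induction D_n computes perm_n exactly; total time polynomial. [difficulty:
provable-now] -/
@[route_item "route-PneNP-PermanentDescent"]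
def UniformizationUnderCollapse : Prop :=
  let PermBits : Language Bool := {w | ∃ (n : ℕ) (s : List Bool) (i : ℕ), s.length = n * n ∧ w = Literature.Computability.Complexity.boolPair s (Computability.encodeNat i) ∧ Nat.testBit (Matrix.permanent (Matrix.of fun a b : Fin n => if s.getD ((b : ℕ) + n * (a : ℕ)) false then (1 : ℕ) else 0)) i = true}; Literature.Computability.Complexity.Nondeterministic.NP ⊆ Literature.Computability.Complexity.Classes.P → PermBits ∈ Literature.Computability.Complexity.PPoly → PermBits ∈ Literature.Computability.Complexity.Classes.P

/-- item stmt-PneNP-16003 · assembly · rank 1 · closed · proved by Summit.PneNP.PneNP.Theorems.permanentDescent_assembly_proof @ e91c8788fb7d (prover) · by planner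
sources: Valiant1979, Toda1991
[assembly] UniformizationUnderCollapse → CollapseShrinksPermanent → PermanentNotInP → PneNP (the
frame; the deciding theorem `closes` proves exactly this implication self-containedly, so this item
is provable-now by `fun u k w => closes u k w`). -/
@[route_item "route-PneNP-PermanentDescent"]
def Assembly : Prop :=
  UniformizationUnderCollapse → CollapseShrinksPermanent → PermanentNotInP → _root_.PneNP

/-! D-0027 §2.1 — DECIDING THEOREM (planner-authored via `route open/edit --closes-file`; by planner-plan-lens-PneNP-move37-v2-g2-0 2026-08-16T17:04:34Z):
its hypotheses are this route's items and its conclusion the sub-problem Statement (glue_lint), and it elaborates with this file. -/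

@[closes "route-PneNP-PermanentDescent"] theorem closes (k : CollapseMakesPermanentEasy) (w : PermanentNotInP) : _root_.PneNP := by
  by_contra h
  have hP : Literature.Computability.Complexity.PNPWave0.P Bool = Literature.Computability.Complexity.Classes.P :=
    Literature.Computability.Complexity.P_bool_eq_holds
  have hN : Literature.Computability.Complexity.PNPWave0.NP Bool = Literature.Computability.Complexity.Nondeterministic.NP :=
    Literature.Computability.Complexity.np_bool_eq
  have hsub : Literature.Computability.Complexity.Nondeterministic.NP ⊆ Literature.Computability.Complexity.Classes.P := by
    intro L hL
    by_contra hL'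
    exact h ⟨L, hN ▸ hL, hP ▸ hL'⟩
  exact w (k hsub)

end Summit.PneNP.PneNP.Theses.PermanentDescent
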